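import Summits.CriticalPhenomena.PercolationContinuityZ3.Theorems.Transplant.SkelNeg1ClosureA
import HarnessLib

/-!
# N1 (the {±1} node), THE RE-ORDERED CLOSURE, LENGTH-BUDGETED FORM (NEG-SCOPE §B.19/B.20, design owner p3-g11, ruling Q-ζ1 03:03Z):
# `samePDropOfSkeletonNeg₁_of_residuesNOWL` — as `…_of_residuesNOWA` (p314230) but with ONE kit accuracy for all three residues:
# the corridor residue is `∃ nmax ≤ Lf K₀, Skel.ReachOblRHN G nmax … (δr 0)` at the FLAT ROOT ACCURACY `δr 0`, and the accuracy
# function `δC` is gone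

builds on p205010 (kernel theorem, internal audit signed; external expert review pending) through `KNLevels.chain_edge_from_source_KN`
(part 7b ← `AdditiveGluing_proof`) and the source-separated corridor packaging of `SkelNeg1ClosureA` §0.  `SamePDropOfSkeletonNeg₁` stays
OPEN (conditional assembly); nothing of record is touched (`…_of_residuesNOW` p286999, `ChoiceNO` p282003, `…_of_residuesNOWA` p314230
all unchanged); this is the closure top the design owner proposes for adoption INSTEAD of the `δC` variant (lane INBOX 03:03Z).
Lane `prim-bschramm`, seat `prim-bschramm-p3` (gen 11; N1 design owner); helper file (`--supports stmt-CriticalPhenomena-4575`).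

WHY (Q-ζ1, stmt-g16 02:57Z): a corridor kit at a SEPARATE accuracy `δC nmax` would need its own level count (∝ 1/δC) and hence its own kit
radius threaded through the cells, or a kit block re-typed over a larger constants record.  But the flat root accuracy the closure constructs
can itself be made fine enough for every corridor within the budget: with `δr 0 = δ0 ≤ 2⁻³⁷ / ((Lf K₀ + 1)(C + 1))` (one more cap in the
running minimum), a linked chain of `n + 1 ≤ Lf K₀ + 1` target steps with kits at `δr 0`, excess `≤ δr 0 / 2` and source (32) at
`δ = 2⁻³⁷` reaches its target with probability `> 1 − 2⁻³⁷ − 2⁻³⁷ ≥ 1 − 2⁻³⁵` (`chain_edge_from_source_KN`).  So the residues receive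
`(K₀, δ, δ₂, δr)` only — the record's `SkelConc.Consts` — with `δr` flat on `[0, Lf K₀]`, the face inner-chain fact, and the corridor
clause `∃ nmax, nmax ≤ Lf K₀ ∧ ReachOblRHN G nmax ⟨Γ, q, δ⟩ FD Φ.Δ (δr 0)`: ONE kit block at any accuracy `≤ δr 0` serves root, faces
and corridor, and the choice-level packaging (companion file `SkelNeg1ChoiceL`) lives over the record's `ChoiceFnNO`.
[cite: KozmaNitzan2024, §4 Theorem 6 (pp. 25–31), Lemmas 10–12; §1 p. 2 (approach 1)] [cite: MartineauTassion2017, §3.4] [this work]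
-/

noncomputable section

open MeasureTheory ProbabilityTheory
open scoped ENNReal Classical

namespace Summit.CriticalPhenomena.PercolationContinuityZ3.Theorems.Transplant

open Literature.Probability.Percolation Literature.Probability.LatticeModels SimpleGraph KNCells KNLevels
open Literature.Barriers.CriticalPhenomena (HasExponentialGrowth)

namespace PlanarSkeletonNeg


/-- **THE N1 PARTIAL CLOSURE FROM THE THREE RESIDUES, ORIENTED, ROOT LAW-CARRYING, CORRIDOR ADDITIVE AND LENGTH-BUDGETED, ONE KIT
ACCURACY.**  As `samePDropOfSkeletonNeg₁_of_residuesNOWA` with two differences: the residues receive NO accuracy function (`K₀, δ, δ₂, δr`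
only, `δr` FLAT on `[0, Lf K₀]`, plus the face inner-chain fact), and the corridor clause is
`∃ nmax, nmax ≤ Lf K₀ ∧ Skel.ReachOblRHN G nmax ⟨Γ, q, δ⟩ FD Φ.Δ (δr 0)` — corridors of any length within the caller's budget `Lf K₀`,
kits at the flat root accuracy.  Proof: `δ := 2⁻³⁷`, `δ₂ := apply_step(δ/2)`, `K₀` from `(1 − δ₂)^{K₀} < 2⁻³⁵` (length-free); `C` from
`chain_edge_from_source_KN`; `δ0 := min (min (min_{k ≤ Lf K₀} δ_chain(k)) (δ₂²/(2((Lf K₀+1)(C+1)+1)))) (2⁻³⁷/((Lf K₀+1)(C+1)))`,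
`δr n := δ0` on `[0, Lf K₀]` and `δ_chain(n)` beyond; the face fact from the `δ₂²`-cap, the corridor bound `1 − 2⁻³⁵` from the
`2⁻³⁷`-cap. [cite: KozmaNitzan2024, §4 Theorem 6 (pp. 25–31); §1 p. 2 (approach 1)] [this work] -/
theorem samePDropOfSkeletonNeg₁_of_residuesNOWL (Lf : ℕ → ℕ)
    (hres : ∀ (K₀ : ℕ) (δ δ₂ : ℝ) (δr : ℕ → ℝ), 0 < δ → δ ≤ 1 → 0 < δ₂ → δ₂ ≤ 1 → (∀ n, 0 < δr n ∧ δr n ≤ 1) →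
      (∀ n, n ≤ Lf K₀ → δr n = δr 0) →
      ∀ {V : Type} [DecidableEq V] [Countable V] (G : SimpleGraph V) [G.LocallyFinite] (Φ : PlanarSkeletonNeg G),
        ¬ HasExponentialGrowth G → ∀ t ∈ Φ.types, Φ.types = {t} → ∀ p : unitInterval, 0 < (p : ℝ) → (p : ℝ) < 1 →
          (∀ᵐ ω ∂bondPercolation G p, numInfiniteClusters ω ≤ 1) → ∀ hC : Φ.CylSubcritical p, 0 < theta G t p →
          (∀ n, n ≤ Lf K₀ → ∀ (q' : unitInterval), (q' : ℝ) < 1 →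
            ∀ (c : V) (Rπ : ℕ) (Wg : Sym2 V → unitInterval) (s : Fin (n + 1) → KNLevels.TStep (Skel.winGraph G c Rπ))
              (T' : Fin (n + 1) → Finset V) (η : ℝ),
              (∀ i : Fin (n + 1), (s i).L.o = (s 0).L.o) →
              (∀ i : Fin n, T' (Fin.castSucc i) ⊆ (s i.succ).L.X 0) →
              (∀ i : Fin (n + 1), T' i ⊆ (s i).T) →
              (∀ i : Fin (n + 1), (s i).KitsAt Wg q' Φ.Δ (δr 0)) →
              η ≤ δr 0 / 2 →
              (∀ i : Fin (n + 1), (prodBernoulli Wg).real (⋃ t ∈ (s i).T \ T' i, openConn (s 0).L.o t) ≤ η) →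
              1 - δr 0 < (prodBernoulli Wg).real (s 0).L.reachB →
                1 - δ₂ ^ 2 < (prodBernoulli Wg).real (⋃ t ∈ T' (Fin.last n), openConn (s 0).L.o t)) →
            ∃ (δI : ℝ) (m₀ : ℕ), 0 < δI ∧ δI < 1 ∧
              ∀ O : Skelφ.StepI.OutO V, O.FactsO Φ.frame hC m₀ t →
                ∃ (Sz : Finset ℕ) (SMn : Finset (ℕ × ℕ)), (∀ M ∈ Sz, O.D.M₀ ≤ M) ∧ (∀ q ∈ SMn, O.D.M₀ ≤ q.1 ∧ O.D.n₁ q.1 ≤ q.2) ∧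
                  ∀ q : unitInterval, (p : ℝ) / 2 ≤ q → (q : ℝ) ≤ p →
                    (∀ i ∈ Skelφ.StepI.indexNP {t} Sz SMn,
                      1 - δI < (bondPercolation G q).real (Skelφ.StepI.eventO G Φ.φ O.D O.DT O.ori i)) →
                    Φ.CylSubcritical q →
                      ∃ (A : Type) (Γ : CellGeom V A) (FD : FaceData V A) (LD : LevelData V A),
                        Γ.root = t ∧ K₀ ≤ Γ.K ∧
                        RunGeom G Γ ∧ AnchGeom Γ ∧ SepGeom₂ G Γ ∧ ExitGeom G Γ ∧ StepsGeom Γ FD ∧ LevelGeom G Γ FD LD ∧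
                        Skel.RootOblTW G (⟨Γ, q, δ⟩ : KSchA V A) Φ.Δ δr ∧
                        Skelφ.FaceOblRM G (⟨Γ, q, δ⟩ : KSchA V A) FD Φ.Δ δ₂ ∧
                        ∃ nmax : ℕ, nmax ≤ Lf K₀ ∧ Skel.ReachOblRHN G nmax (⟨Γ, q, δ⟩ : KSchA V A) FD Φ.Δ (δr 0)) :
    SamePDropOfSkeletonNeg₁ := by
  refine samePDropOfSkeletonNeg₁_of_stepI_runO fun {V} _ _ G _ Φ hg t ht h1 p hp0 hp1 hU hC hθ => ?_
  have hε' : (0 : ℝ) < (1 / 2) ^ 35 := by positivity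
  have hΔ : ∀ v, G.degree v ≤ Φ.Δ := Φ.degree_le
  -- (1) the scheme threshold `δc := 2⁻³⁷`, length-free
  set δ : ℝ := (1 / 2) ^ 37 with hδdef
  have hδ0 : 0 < δ := by positivity
  have hδ1 : δ ≤ 1 := by rw [hδdef]; norm_num
  -- (2) the face accuracy, the TRUE root chain accuracies (bundled lemmas: their sources are certain), then `K₀`
  obtain ⟨δ₂, hδ₂0, hδ₂1, hstep⟩ := SkelConc.apply_step_subgraph_UP G hΔ (half_pos hδ0)
  have hrc := fun n : ℕ => SkelConc.chain_edge_subgraph_UP G hΔ n hδ0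
  choose δt hδt0 hδt1 hchaint using hrc
  obtain ⟨K₀, hK₀⟩ := exists_pow_lt_of_lt_one hε' (show 1 - δ₂ < 1 by linarith)
  -- (3) the SOURCE-ADDITIVE chain estimate (constant `C`)
  obtain ⟨C, hC0, hchA⟩ := KNLevels.chain_edge_from_source_KN (V := V) (Δ := Φ.Δ)
  -- (4) the FLAT root table on `[0, Lf K₀]`: the running minimum of the true accuracies, capped TWICE — for the face inner-chain fact
  -- (`δ₂²`-cap) and for the corridor (`2⁻³⁷`-cap: a corridor of `≤ Lf K₀ + 1` rounds at accuracy `δr 0` loses `≤ 2⁻³⁷`)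
  set LF : ℕ := Lf K₀ with hLF
  have hmin : ∀ L : ℕ, ∃ δm : ℝ, 0 < δm ∧ δm ≤ 1 ∧ ∀ k, k ≤ L → δm ≤ δt k := by
    intro L
    induction L with
    | zero => exact ⟨δt 0, hδt0 0, hδt1 0, fun k hk => by rw [Nat.le_zero.1 hk]⟩
    | succ m ih =>
      obtain ⟨δm, hm0, hm1, hm⟩ := ih
      refine ⟨min δm (δt (m + 1)), lt_min hm0 (hδt0 _), (min_le_left _ _).trans hm1, fun k hk => ?_⟩
      rcases Nat.lt_or_ge k (m + 1) with hlt | hge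
      · exact (min_le_left _ _).trans (hm k (by omega))
      · obtain rfl : k = m + 1 := le_antisymm hk hge
        exact min_le_right _ _
  obtain ⟨δm, hδm0, hδm1, hδm⟩ := hmin LF
  set cap : ℝ := δ₂ ^ 2 / (2 * (((LF + 1 : ℕ) : ℝ) * (C + 1) + 1)) with hcapdef
  have hcapden : (0 : ℝ) < 2 * (((LF + 1 : ℕ) : ℝ) * (C + 1) + 1) := by positivity
  have hcap0 : 0 < cap := div_pos (by positivity) hcapden
  set capC : ℝ := (1 / 2 : ℝ) ^ 37 / (((LF + 1 : ℕ) : ℝ) * (C + 1)) with hcapCdef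
  have hcapCden : (0 : ℝ) < ((LF + 1 : ℕ) : ℝ) * (C + 1) := by positivity
  have hcapC0 : 0 < capC := div_pos (by positivity) hcapCden
  set δ0 : ℝ := min (min δm cap) capC with hδ0def
  have hδ00 : 0 < δ0 := lt_min (lt_min hδm0 hcap0) hcapC0
  have hδ01 : δ0 ≤ 1 := ((min_le_left _ _).trans (min_le_left _ _)).trans hδm1
  have hδ0t : ∀ k, k ≤ LF → δ0 ≤ δt k := fun k hk => ((min_le_left _ _).trans (min_le_left _ _)).trans (hδm k hk)
  have hδ0cap : δ0 ≤ cap := (min_le_left _ _).trans (min_le_right _ _)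
  have hδ0capC : δ0 ≤ capC := min_le_right _ _
  set δr : ℕ → ℝ := fun n => if n ≤ LF then δ0 else δt n with hδrdef
  have hδr_le : ∀ n, δr n ≤ δt n := fun n => by
    simp only [hδrdef]; split_ifs with h
    · exact hδ0t n h
    · exact le_rfl
  have hδr0 : ∀ n, 0 < δr n := fun n => by simp only [hδrdef]; split_ifs <;> [exact hδ00; exact hδt0 n]
  have hδr1 : ∀ n, δr n ≤ 1 := fun n => (hδr_le n).trans (hδt1 n)
  have hflat : ∀ n, n ≤ LF → δr n = δr 0 := fun n hn => by simp only [hδrdef, if_pos hn, if_pos (Nat.zero_le _)]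
  have hδr00 : δr 0 = δ0 := by simp only [hδrdef, if_pos (Nat.zero_le _)]
  -- the root chain property at the flat table (kits are monotone in the accuracy)
  have hchainr : ∀ (n : ℕ) (q : unitInterval), (q : ℝ) < 1 → ∀ (G' : SimpleGraph V) [G'.LocallyFinite], G' ≤ G →
      ∀ (Wt : Sym2 V → unitInterval) (s : Fin (n + 1) → TStep G') (T' : Fin (n + 1) → Finset V) (η : ℝ),
      (∀ i : Fin (n + 1), (s i).L.o = (s 0).L.o) →
      (∀ i : Fin n, T' (Fin.castSucc i) ⊆ (s i.succ).L.X 0) →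
      (∀ i : Fin (n + 1), T' i ⊆ (s i).T) →
      (∀ i : Fin (n + 1), (s i).KitsAt Wt q Φ.Δ (δr n)) →
      η ≤ δr n / 2 →
      (∀ i : Fin (n + 1), (prodBernoulli Wt).real (⋃ t ∈ (s i).T \ T' i, openConn (s 0).L.o t) ≤ η) →
      1 - δr n < (prodBernoulli Wt).real (s 0).L.reachB →
        1 - δ < (prodBernoulli Wt).real (⋃ t ∈ T' (Fin.last n), openConn (s 0).L.o t) := by
    intro n q hq1 G' _ hG' Wt s T' η ho hlink hsub hkits hη hexc hsrc
    exact hchaint n q hq1 G' hG' Wt s T' η ho hlink hsub (fun i => (hkits i).mono (hδr_le n))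
      (hη.trans (by linarith [hδr_le n])) hexc (lt_of_le_of_lt (by linarith [hδr_le n]) hsrc)
  -- the face inner-chain fact at `δr 0 = δ0`
  have hchainF : ∀ n, n ≤ Lf K₀ → ∀ (q' : unitInterval), (q' : ℝ) < 1 →
      ∀ (c : V) (Rπ : ℕ) (Wg : Sym2 V → unitInterval) (s : Fin (n + 1) → KNLevels.TStep (Skel.winGraph G c Rπ))
        (T' : Fin (n + 1) → Finset V) (η : ℝ),
        (∀ i : Fin (n + 1), (s i).L.o = (s 0).L.o) →
        (∀ i : Fin n, T' (Fin.castSucc i) ⊆ (s i.succ).L.X 0) →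
        (∀ i : Fin (n + 1), T' i ⊆ (s i).T) →
        (∀ i : Fin (n + 1), (s i).KitsAt Wg q' Φ.Δ (δr 0)) →
        η ≤ δr 0 / 2 →
        (∀ i : Fin (n + 1), (prodBernoulli Wg).real (⋃ t ∈ (s i).T \ T' i, openConn (s 0).L.o t) ≤ η) →
        1 - δr 0 < (prodBernoulli Wg).real (s 0).L.reachB →
          1 - δ₂ ^ 2 < (prodBernoulli Wg).real (⋃ t ∈ T' (Fin.last n), openConn (s 0).L.o t) := by
    intro n hn q' hq' c Rπ Wg s T' η ho hlink hsub hkits hη hexc hsrc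
    rw [hδr00] at hkits hη hsrc
    have hGc : ∀ x, (Skel.winGraph G c Rπ).degree x ≤ Φ.Δ := SkelConc.degree_le_of_subgraph G hΔ _ (Skel.winGraph_le G c Rπ)
    have hmain := hchA n hδ00 hδ01 δ0 q' hq' (Skel.winGraph G c Rπ) hGc Wg s T' η ho hlink hsub hkits hexc hsrc
    have hη1 : 0 ≤ η := measureReal_nonneg.trans (hexc 0)
    have hn1 : ((n + 1 : ℕ) : ℝ) ≤ (LF + 1 : ℕ) := by rw [hLF]; exact_mod_cast Nat.succ_le_succ hn
    have hkey : δ0 + ((n + 1 : ℕ) : ℝ) * (C * δ0 + η) ≤ δ₂ ^ 2 / 2 := by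
      have h1 : C * δ0 + η ≤ (C + 1) * δ0 := by linarith
      have h2 : ((n + 1 : ℕ) : ℝ) * (C * δ0 + η) ≤ ((LF + 1 : ℕ) : ℝ) * ((C + 1) * δ0) :=
        mul_le_mul hn1 h1 (add_nonneg (mul_nonneg hC0 hδ00.le) hη1) (by positivity)
      have h3 : δ0 * (2 * (((LF + 1 : ℕ) : ℝ) * (C + 1) + 1)) ≤ δ₂ ^ 2 := (le_div_iff₀ hcapden).1 hδ0cap
      linarith
    have hδ₂sq : (0 : ℝ) < δ₂ ^ 2 := by positivity
    linarith
  -- (5) the residues at these constants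
  obtain ⟨δI, m₀, hδI, hδI1, hS⟩ := hres K₀ δ δ₂ δr hδ0 hδ1 hδ₂0 hδ₂1 (fun n => ⟨hδr0 n, hδr1 n⟩)
    hflat G Φ hg t ht h1 p hp0 hp1 hU hC hθ hchainF
  refine ⟨δI, m₀, hδI, hδI1, fun D DT ori hk₀ hk₁ hkM hR hΛ e1 e2 e3 e4 e5 hgeom => ?_⟩
  obtain ⟨Sz, SMn, hSz, hSMn, hB⟩ := hS ⟨D, DT, ori⟩ ⟨hk₀, hk₁, hkM, hR, hΛ, e1, e2, e3, e4, e5, hgeom⟩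
  refine ⟨Sz, SMn, hSz, hSMn, fun q hq1 hq2 hcq hCq => ?_⟩
  have hq1' : (q : ℝ) < 1 := lt_of_le_of_lt hq2 hp1
  obtain ⟨A, Γ, FD, LD, hroot, hK, hrun, hanch, hsep, hexit, hsteps, hlev, hrootO, hfaceO, nmax, hnmax, hreachO⟩ :=
    hB q hq1 hq2 hcq hCq
  refine ⟨A, ⟨Γ, q, δ⟩, FD, LD, (1 / 2) ^ 35, δ₂, hroot, rfl, hrun, hanch, hsep, hexit, hsteps, hlev, hδ1, hε'.le, hδ₂1, ?_, ?_⟩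
  · have hKpow : (1 - δ₂) ^ Γ.K ≤ (1 / 2 : ℝ) ^ 35 := (pow_le_pow_of_le_one (by linarith) (by linarith) hK).trans hK₀.le
    have h32 : (4 : ℝ) * ((1 / 2) ^ 35 + (1 / 2) ^ 35) = (1 / 2) ^ 32 := by norm_num
    show 4 * ((1 - δ₂) ^ Γ.K + (1 / 2 : ℝ) ^ 35) ≤ (1 / 2) ^ 32
    linarith
  · refine Skelφ.kitAtRun_of_oblRHNMW_src (S := ⟨Γ, q, δ⟩)
      (fun c Rπ => hstep q hq1' (Skel.winGraph G c Rπ) (Skel.winGraph_le G c Rπ)) ?_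
      (fun n c Rπ => hchainr n q hq1' (Skel.winGraph G c Rπ) (Skel.winGraph_le G c Rπ)) hrootO hfaceO hreachO
    -- the corridor chains: source at `δc = 2⁻³⁷`, kits at the FLAT root accuracy `δr 0 = δ0`, `n ≤ nmax ≤ Lf K₀` rounds ⟹ `2⁻³⁵`
    intro n hn Ω Wg s T' η ho hlink hsub hkits hη hexc hsrc
    rw [hδr00] at hkits hη
    have hGΩ : ∀ x, (Skel.winGraphIn G Ω).degree x ≤ Φ.Δ := SkelConc.degree_le_of_subgraph G hΔ _ (Skel.winGraphIn_le G Ω)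
    have hη1 : 0 ≤ η := measureReal_nonneg.trans (hexc 0)
    have hmain := hchA n hδ00 hδ01 δ q hq1' (Skel.winGraphIn G Ω) hGΩ Wg s T' η ho hlink hsub hkits hexc hsrc
    -- arithmetic: `δ + (n+1)(C·δ0 + η) ≤ 2⁻³⁷ + 2⁻³⁷ ≤ 2⁻³⁵` (by the corridor cap `δ0 ≤ 2⁻³⁷ / ((Lf K₀ + 1)(C + 1))`)
    have hn1 : ((n + 1 : ℕ) : ℝ) ≤ (LF + 1 : ℕ) := by rw [hLF]; exact_mod_cast Nat.succ_le_succ (hn.trans hnmax)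
    have hkey : ((n + 1 : ℕ) : ℝ) * (C * δ0 + η) ≤ (1 / 2 : ℝ) ^ 37 := by
      have h1 : C * δ0 + η ≤ (C + 1) * δ0 := by linarith
      have h2 : ((n + 1 : ℕ) : ℝ) * (C * δ0 + η) ≤ ((LF + 1 : ℕ) : ℝ) * ((C + 1) * δ0) :=
        mul_le_mul hn1 h1 (add_nonneg (mul_nonneg hC0 hδ00.le) hη1) (by positivity)
      have h3 : δ0 * (((LF + 1 : ℕ) : ℝ) * (C + 1)) ≤ (1 / 2 : ℝ) ^ 37 := (le_div_iff₀ hcapCden).1 hδ0capC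
      linarith
    have h35 : (1 / 2 : ℝ) ^ 37 + (1 / 2) ^ 37 ≤ (1 / 2) ^ 35 := by norm_num
    have hb : δ + ((n + 1 : ℕ) : ℝ) * (C * δ0 + η) ≤ (1 / 2 : ℝ) ^ 35 := by
      have hδeq : δ = (1 / 2 : ℝ) ^ 37 := hδdef
      rw [hδeq]; linarith
    exact lt_of_le_of_lt (by linarith) hmain

end PlanarSkeletonNeg

end Summit.CriticalPhenomena.PercolationContinuityZ3.Theorems.Transplant

end
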